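import Summits.Parity.GeneralizedHardyLittlewood.Theorems.GreenTaoLevelTwoMNTwoProgressionAveraging2

/-!
# Route `GreenTaoLevelTwo`, crux `MNTwo` (stmt-Parity-21276), line `birth`, stub `stub_mnVertical`:
# a progression base point with a large double sum (GT 2008b §10, proof of Lemma 24)

Second step of the remaining Lemma-24 assembly for `stub_mnVertical` (B. Green, T. Tao,
*Quadratic uniformity of the Möbius function*, Ann. Inst. Fourier 58 (2008) = arXiv:math/0606087,
§10: "Hence by the pigeonhole principle there exist `d, w` such that
`|𝔼_{1≤l≤L} 𝔼_{1≤m≤M} ψ((d+sl)(w+tm)) e(φ((d+sl)(w+tm))) b(d+sl) b(w+tm)| ≳ 1`").  Def-free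
quantitative wrapper of `…MNTwoProgressionAveraging2.exists_large_progression₂` for the box
`[K+1, 2K] × [1, W]` of `…MNTwoTypeIIXformInt.typeII_Xform_int`: if `L|s| ≤ εK`, `M|t| ≤ εW` with
`ε ≤ 1/2` then the two windows have at most `2K` and `2W` elements, so some base point `(d, w)`
has `X·L·M/(4KW) ≤ ‖∑_{l≤L} ∑_{m≤M} G(d+sl, w+tm)‖` whenever `X ≤ ‖∑_{box} G‖`.

* `card_window_le` — `#[a − |s|L, b + |s|L] ≤ 2K`-type bound;
* `typeII_base_point` — the statement just described.

References: [GreenTao2008QuadraticMobius] arXiv:math/0606087 §10 (proof of Lemma 24).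
-/

noncomputable section

open Finset

namespace Summit.Parity.GeneralizedHardyLittlewood.GreenTaoLevelTwoMNTwoTypeIIBasePoint

open Summit.Parity.GeneralizedHardyLittlewood.GreenTaoLevelTwoMNTwoProgressionAveraging2
  (exists_large_progression₂)

/-- The enlarged window `[a − |s|L, a + n − 1 + |s|L]` of an interval of length `n ≥ 1` has
`n + 2|s|L` elements, hence at most `2n` if `L|s| ≤ n/2`. [folklore] -/
theorem card_window_le (a s : ℤ) (n L : ℕ) (hn : 1 ≤ n) (hs : (L : ℝ) * |(s : ℝ)| ≤ (n : ℝ) / 2) :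
    (#(Icc (a - |s| * L) (a + n - 1 + |s| * L)) : ℝ) ≤ 2 * n := by
  rw [Int.card_Icc]
  have h0 : 0 ≤ a + n - 1 + |s| * (L : ℤ) + 1 - (a - |s| * (L : ℤ)) := by
    have := abs_nonneg s; nlinarith
  have e : (((a + n - 1 + |s| * (L : ℤ) + 1 - (a - |s| * (L : ℤ))).toNat : ℕ) : ℝ) =
      ((a + n - 1 + |s| * (L : ℤ) + 1 - (a - |s| * (L : ℤ)) : ℤ) : ℝ) := by
    exact_mod_cast Int.toNat_of_nonneg h0
  rw [e]
  push_cast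
  have h1 : |(s : ℝ)| * (L : ℝ) ≤ (n : ℝ) / 2 := by rw [mul_comm]; exact hs
  linarith

/-- **A base point with a large progression sum.**  Let `G : ℤ → ℤ → ℂ` vanish outside the box
`[K+1, 2K] × [1, W]` (`K, W ≥ 1`) and `X ≤ ‖∑_{box} G‖`.  If `L, M ≥ 1`, `L|s| ≤ εK`,
`M|t| ≤ εW`, `ε ≤ 1/2`, then some `d ∈ [K+1−|s|L, 2K+|s|L]`, `w ∈ [1−|t|M, W+|t|M]` has
`X·L·M/(4KW) ≤ ‖∑_{l=1}^{L} ∑_{m=1}^{M} G(d+sl, w+tm)‖`.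
[cite: GreenTao2008QuadraticMobius, §10 (proof of Lemma 24, "there exist `d, w` such that")] -/
theorem typeII_base_point (G : ℤ → ℤ → ℂ) {K W : ℕ} (hK : 1 ≤ K) (hW : 1 ≤ W)
    (hG : ∀ d w : ℤ, (d ∉ Icc (((K + 1 : ℕ)) : ℤ) ((2 * K : ℕ) : ℤ) ∨
      w ∉ Icc (((1 : ℕ)) : ℤ) ((W : ℕ) : ℤ)) → G d w = 0)
    {X : ℝ} (hX : X ≤ ‖∑ d ∈ Icc (((K + 1 : ℕ)) : ℤ) ((2 * K : ℕ) : ℤ),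
      ∑ w ∈ Icc (((1 : ℕ)) : ℤ) ((W : ℕ) : ℤ), G d w‖)
    (s t : ℤ) {L M : ℕ} (hL : 1 ≤ L) (hM : 1 ≤ M) {ε : ℝ} (hε : ε ≤ 1 / 2)
    (hs : (L : ℝ) * |(s : ℝ)| ≤ ε * K) (ht : (M : ℝ) * |(t : ℝ)| ≤ ε * W) :
    ∃ d ∈ Icc ((((K + 1 : ℕ)) : ℤ) - |s| * L) (((2 * K : ℕ) : ℤ) + |s| * L),
      ∃ w ∈ Icc ((((1 : ℕ)) : ℤ) - |t| * M) (((W : ℕ) : ℤ) + |t| * M),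
        X * L * M / (4 * K * W) ≤
          ‖∑ l ∈ Icc (1 : ℕ) L, ∑ m ∈ Icc (1 : ℕ) M, G (d + s * l) (w + t * m)‖ := by
  have hKr : (0 : ℝ) < K := by exact_mod_cast hK
  have hWr : (0 : ℝ) < W := by exact_mod_cast hW
  have hab : (((K + 1 : ℕ)) : ℤ) ≤ ((2 * K : ℕ) : ℤ) := by push_cast; omega
  have hab' : (((1 : ℕ)) : ℤ) ≤ ((W : ℕ) : ℤ) := by exact_mod_cast hW
  obtain ⟨d, hd, w, hw, hmain⟩ := exists_large_progression₂ hab hab' hG s t L M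
  refine ⟨d, hd, w, hw, ?_⟩
  -- window sizes
  have hcd : (#(Icc ((((K + 1 : ℕ)) : ℤ) - |s| * L) (((2 * K : ℕ) : ℤ) + |s| * L)) : ℝ) ≤ 2 * K := by
    have e : ((2 * K : ℕ) : ℤ) = (((K + 1 : ℕ)) : ℤ) + (K : ℕ) - 1 := by push_cast; ring
    rw [e]
    exact card_window_le _ s K L hK (by nlinarith [hs, hε, abs_nonneg (s : ℝ), hKr])
  have hcw : (#(Icc ((((1 : ℕ)) : ℤ) - |t| * M) (((W : ℕ) : ℤ) + |t| * M)) : ℝ) ≤ 2 * W := by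
    have e : ((W : ℕ) : ℤ) = (((1 : ℕ)) : ℤ) + (W : ℕ) - 1 := by push_cast; ring
    rw [e]
    exact card_window_le _ t W M hW (by nlinarith [ht, hε, abs_nonneg (t : ℝ), hWr])
  set S : ℝ := ‖∑ l ∈ Icc (1 : ℕ) L, ∑ m ∈ Icc (1 : ℕ) M, G (d + s * l) (w + t * m)‖ with hS
  have hS0 : 0 ≤ S := norm_nonneg _
  have h1 : (L : ℝ) * M * X ≤ (2 * K) * (2 * W) * S := by
    calc (L : ℝ) * M * X ≤ (L : ℝ) * M * ‖∑ d ∈ Icc (((K + 1 : ℕ)) : ℤ) ((2 * K : ℕ) : ℤ),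
          ∑ w ∈ Icc (((1 : ℕ)) : ℤ) ((W : ℕ) : ℤ), G d w‖ :=
          mul_le_mul_of_nonneg_left hX (by positivity)
      _ ≤ _ := hmain
      _ ≤ (2 * K) * (2 * W) * S := by
          have := mul_le_mul hcd hcw (by positivity) (by positivity)
          exact mul_le_mul_of_nonneg_right this hS0
  rw [div_le_iff₀ (by positivity)]
  linarith

end Summit.Parity.GeneralizedHardyLittlewood.GreenTaoLevelTwoMNTwoTypeIIBasePoint
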